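import Literature.Analysis.FluidPDE.NSSereginMildStabilityHolds
import HarnessLib

/-!
# Uniform boundedness of local Leray approximants below a regular top point
# (the quantitative form of Lemarié-Rieusset's stability of singular points at the final time)

Analysis/FluidPDE proof file (theorems only: no definition, no named fact, no `sorry`).

The tree's `lemarieRieusset_singular_point_stability` (`NSSereginMildFacts.lean`, discharged in
`NSSereginMildStabilityHolds.lean`; P. G. Lemarié-Rieusset, *The Navier–Stokes Problem in the
21st Century* (2016), proof of Thm. 15.5, PDF pp. 571–573, (15.5)–(15.6) with Thm. 14.4; interior
form Rusin–Šverák 2011, Lemma 2.1) concludes that the approximants `v_n` are *essentially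
bounded* on a cylinder `Q_{r₁}(T, x₀)` for large `n` — a bound that may depend on `n`. Its proof
(`singular_point_stability_unit`, `NSSereginMildStabilityCore.lean`) in fact produces a bound
**independent of `n`**: the scale `s = θᴶ r_B` at which `C_n(s) + D_n(s) ≤ ε₀³` is chosen from
the limit and the uniform local-energy constant only, and Thm. 14.4 then bounds `|v_n|` by
`C₀ ε₀ / s` a.e. on `Q_{s/2}(T, x₀)` ("`sup_{Q₁} |u| ≤ C₀ λ / r₀`", Lemarié-Rieusset 2016, Thm. 14.4,
p. 505). This uniform form is the one needed to turn the vanishing of a blow-down limit into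
decay of the original solution — Albritton–Barker 2019, proof of Thm. 4.1 (J. Math. Fluid Mech.
21 (2019) no. 43 = arXiv:1811.00502, §4 p. 9: the bound (4.4)
`limsup_k √(|t_k|/2) ‖v‖_{L^∞(Q(√(|t_k|/2)))} < ∞` is the uniform bound for the rescaled
sequence `v^{(k)}` on `Q(1/2)`; "persistence of singularities" after Rusin–Šverák) — on the
discharge path of `Literature.Analysis.FluidPDE.AlbrittonBarker2019_liouville_weakL3_backward`
(`AncientL3BackwardLiouville.lean`). This file records it:

* `exists_oneScale_top_bound_of_LR` — Thm. 14.4 at the final time of a slab with its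
  **quantitative** conclusion `|u| ≤ K / s` a.e. on `Q_{s/2}(T, x₀)`, `K = C₀ ε₀` (verbatim the
  tree's `exists_oneScale_top_of_LR`, `NSSereginMildStabilityOneScale.lean`, minus the final
  weakening to `L^∞`-finiteness);
* `uniform_top_bound_of_bounded_limit_unit` — for slab local Leray solutions `v_n → v_∞` in
  `L²_loc` with uniform uniformly-local energy bounds (unit viscosity) and `v_∞` essentially
  bounded on some `Q_{r₀}(T, x₀)`: there are `r₁ > 0` and `K₁` with `|v_n| ≤ K₁` a.e. on
  `Q_{r₁}(T, x₀)` for all large `n` (verbatim the tree's `singular_point_stability_unit` with the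
  three named facts it consumes fed by their discharges `lemarieRieusset_epsilon_regularity_holds`,
  `seregin_sverak_pressure_decay_holds`, `kangMiuraTsai_local_pressure_bound_holds`, and the
  quantitative one-scale criterion);
Nothing accepted is restated or changed (the tree's qualitative statement follows from the
uniform one by `eLpNormEssSup_lt_top_of_ae_bound`).

## Mathlib / tree search

`lean search 'uniform_top_bound|oneScale_top_bound|singular_point_stability'`: only the
qualitative statements quoted above (2026-08-17). Reused by name:
`lemarieRieusset_epsilon_regularity_iff`, `IsLRSuitableWeakSolutionOn`, `parabolicCylinderOpens`,
`parabolicCylinder_top_subset_box`, `parabolicCylinder_top_subset_slab`,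
`lintegral_indicator_prod_slice`, `tendsto_lintegral_cube_parabolicCylinder`,
`cknC_le_of_ae_bound_of_lintegral_sub`, `cknD_iterate_le_of_pressure_decay`,
`exists_ratio_mul_le_half`, `exists_forall_ofReal_pow_three_mul_le`, `exists_inv_two_pow_mul_le`,
`IsSuitableWeakSolutionOn.sub_timeGauge_slab`, `IsLocalLeraySolutionOn.lintegral_ball_datum_le`,
`.isWeaklyDivFree_datum`, `eLpNormEssSup_lt_top_of_ae_bound`.

## References

* P. G. Lemarié-Rieusset, *The Navier–Stokes Problem in the 21st Century*, CRC Press (2016),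
  doi:10.1201/b19556: Thm. 14.4 (PDF p. 505); proof of Thm. 15.5, pp. 571–573, (15.5)–(15.6).
  [`LemarieRieusset2016`]
* W. Rusin, V. Šverák, J. Funct. Anal. 260 (2011) = arXiv:0911.0500, Lemma 2.1. [`RusinSverak2011`]
* D. Albritton, T. Barker, J. Math. Fluid Mech. 21 (2019), Paper No. 43 = arXiv:1811.00502, §4,
  Thm. 4.1, (4.4). [`AlbrittonBarker2019`]
-/

noncomputable section

open MeasureTheory TopologicalSpace Set Function Filter Metric Module
open _root_.Topology
open scoped ENNReal NNReal RealInnerProductSpace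

namespace Literature.Analysis.FluidPDE

/-! ### Thm. 14.4 at the top of the slab, quantitative conclusion -/

/-- **Thm. 14.4 at the final time of a slab, with its sup bound** (Lemarié-Rieusset 2016,
Thm. 14.4, p. 505: "`u` is bounded on `Q₁ = Q_{r₀/2}(t₀, x₀)` with `sup_{Q₁} |u| ≤ C₀ λ / r₀`",
applied as on p. 573 with `Ω = Q_s(T, x₀)` itself). From `lemarieRieusset_epsilon_regularity`
there are `ε₀ > 0` and `K ≥ 0` (`K = C₀ ε₀`) such that: if `(u, p)` is a suitable weak solution
of the unforced unit-viscosity equations on the open slab `(0, T) × ℝ³` with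
`∫_{B₁(x₁)} |u(t)|² ≤ C` for a.e. `t ∈ (0,T)` and all `x₁`, some weak spatial gradient `G` of `u`
on the slab with `∫₀ᵀ∫_{B₁(x₀)} |G|² < ∞`, and `∫₀ᵀ∫_{B₁(x₀)} |p|^{3/2} < ∞`, then for
`0 < s ≤ 1`, `s² ≤ T`, `C(s; (T,x₀)) + D(s; (T,x₀)) ≤ ε₀³` implies `|u| ≤ K / s` a.e. on
`Q_{s/2}(T, x₀)`. The proof is that of the tree's `exists_oneScale_top_of_LR` without its last
line. [cite: LemarieRieusset2016, Thm. 14.4 (PDF p. 505) as applied on p. 573] -/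
theorem exists_oneScale_top_bound_of_LR (hε : lemarieRieusset_epsilon_regularity) :
    ∃ ε₀ K : ℝ, 0 < ε₀ ∧ 0 ≤ K ∧ ∀ (T : ℝ) (x₀ : EuclideanSpace ℝ (Fin 3)) (s : ℝ)
      (u : ℝ → EuclideanSpace ℝ (Fin 3) → EuclideanSpace ℝ (Fin 3))
      (p : ℝ → EuclideanSpace ℝ (Fin 3) → ℝ) (C : ℝ≥0),
      0 < s → s ≤ 1 → s ^ 2 ≤ T →
      IsSuitableWeakSolutionOn (slab (EuclideanSpace ℝ (Fin 3)) (Ioo 0 T) isOpen_Ioo) 1 0 u p →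
      (∀ᵐ t ∂(volume.restrict (Ioo 0 T)), ∀ x₁ : EuclideanSpace ℝ (Fin 3),
        ∫⁻ x in ball x₁ 1, ‖u t x‖ₑ ^ 2 ≤ C) →
      (∃ G : ℝ → EuclideanSpace ℝ (Fin 3) →
          EuclideanSpace ℝ (Fin 3) →L[ℝ] EuclideanSpace ℝ (Fin 3),
        HasWeakSpatialGradientOn (slab (EuclideanSpace ℝ (Fin 3)) (Ioo 0 T) isOpen_Ioo) u G ∧
          ∫⁻ z in Ioo 0 T ×ˢ ball x₀ 1, ENNReal.ofReal (frobeniusNormSq (G z.1 z.2)) < ∞) →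
      ∫⁻ z in Ioo 0 T ×ˢ ball x₀ 1, ‖p z.1 z.2‖ₑ ^ (3 / 2 : ℝ) < ∞ →
      cknC s ((T : ℝ), x₀) u + cknD s ((T : ℝ), x₀) p ≤ ENNReal.ofReal (ε₀ ^ 3) →
      ∀ᵐ w ∂(volume.restrict (parabolicCylinder (s / 2) ((T : ℝ), x₀))), ‖u w.1 w.2‖ ≤ K / s := by
  obtain ⟨ε₀, C₀, hε₀, hC₀, H⟩ :=
    (lemarieRieusset_epsilon_regularity_iff.1 hε) 1 3 one_pos (by norm_num)
  refine ⟨ε₀, C₀ * ε₀, hε₀, by positivity, fun T x₀ s u p C hs hs1 hsT hsws hCu hGu hp hsmall => ?_⟩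
  set z : ℝ × EuclideanSpace ℝ (Fin 3) := ((T : ℝ), x₀) with hz
  set Ω : Opens (ℝ × EuclideanSpace ℝ (Fin 3)) := parabolicCylinderOpens s z with hΩ
  have hΩcoe : (Ω : Set (ℝ × EuclideanSpace ℝ (Fin 3))) = parabolicCylinder s z :=
    coe_parabolicCylinderOpens s z
  have hΩbox : (Ω : Set (ℝ × EuclideanSpace ℝ (Fin 3))) ⊆ Ioo (0 : ℝ) T ×ˢ ball x₀ 1 := by
    rw [hΩcoe]; exact parabolicCylinder_top_subset_box hs1 hsT x₀
  have hΩle : Ω ≤ slab (EuclideanSpace ℝ (Fin 3)) (Ioo 0 T) isOpen_Ioo := by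
    intro w hw
    have hw' : w ∈ (Ω : Set (ℝ × EuclideanSpace ℝ (Fin 3))) := hw
    rw [hΩcoe] at hw'
    exact parabolicCylinder_top_subset_slab hsT x₀ hw'
  -- the gradient of the local energy inequality and the bounded gradient agree a.e.
  obtain ⟨G₀, hG₀, -, hloc⟩ := hsws.localEnergy
  obtain ⟨G, hG, hGfin⟩ := hGu
  have hae := hG₀.ae_eq hG
  have hslabcoe : ((slab (EuclideanSpace ℝ (Fin 3)) (Ioo 0 T) isOpen_Ioo :
      Opens (ℝ × EuclideanSpace ℝ (Fin 3))) : Set (ℝ × EuclideanSpace ℝ (Fin 3))) =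
      Ioo (0 : ℝ) T ×ˢ univ := coe_slab _ _
  have hΩslab : (Ω : Set (ℝ × EuclideanSpace ℝ (Fin 3))) ⊆ Ioo (0 : ℝ) T ×ˢ univ :=
    hΩbox.trans (prod_mono Subset.rfl (subset_univ _))
  -- the standing hypotheses of Thm. 14.4 on `Ω`
  have hLR : IsLRSuitableWeakSolutionOn Ω 1 3 0 u p G₀ :=
    { isConnected := by
        rw [hΩcoe, parabolicCylinder]
        exact (isConnected_Ioo (by nlinarith : z.1 - s ^ 2 < z.1)).prod (isConnected_ball hs)
      energyClass := by
        refine ⟨C, ?_⟩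
        have hCu' := (ae_restrict_iff' (measurableSet_Ioo : MeasurableSet (Ioo (0 : ℝ) T))).1 hCu
        filter_upwards [hCu'] with t ht
        rw [hΩcoe, parabolicCylinder,
          lintegral_indicator_prod_slice measurableSet_ball (fun w => ‖u w.1 w.2‖ₑ ^ 2) t]
        have hz1 : z.1 = T := rfl
        have hz2 : z.2 = x₀ := rfl
        rw [hz1, hz2]
        by_cases htI : t ∈ Ioo (T - s ^ 2) T
        · rw [indicator_of_mem htI]
          have ht0 : t ∈ Ioo (0 : ℝ) T := ⟨by linarith [htI.1], htI.2⟩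
          exact (lintegral_mono_set (ball_subset_ball hs1)).trans (ht ht0 x₀)
        · rw [indicator_of_notMem htI]
          exact zero_le
      weakGradient := hG₀.mono hΩle
      gradient_lt_top := by
        have hae' : ∀ᵐ w ∂(volume.restrict (Ω : Set (ℝ × EuclideanSpace ℝ (Fin 3)))),
            ENNReal.ofReal (frobeniusNormSq (G₀ w.1 w.2)) =
              ENNReal.ofReal (frobeniusNormSq (G w.1 w.2)) := by
          rw [hslabcoe] at hae
          filter_upwards [ae_restrict_of_ae_restrict_of_subset hΩslab hae] with w hw
          have hw' : G₀ w.1 w.2 = G w.1 w.2 := hw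
          rw [hw']
        rw [lintegral_congr_ae hae']
        exact (lintegral_mono_set hΩbox).trans_lt hGfin
      pressure_lt_top := (lintegral_mono_set hΩbox).trans_lt hp
      force_memLp := by
        rw [uncurry_zero]
        exact MemLp.zero
      distributional := (hsws.of_le hΩle).distributional
      localEnergy := fun φ hφ hφ0 => hloc φ (hφ.mono hΩle) hφ0 }
  -- (14.17) with `λ = ε₀`
  have hmeas : AEMeasurable (fun w : ℝ × EuclideanSpace ℝ (Fin 3) => ‖u w.1 w.2‖ₑ ^ (3 : ℕ))
      (volume.restrict (parabolicCylinder s z)) := by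
    have h1 : AEStronglyMeasurable (uncurry u)
        (volume.restrict (parabolicCylinder s z)) := by
      have h0 := hsws.distributional.1.aestronglyMeasurable
      rw [hslabcoe] at h0
      exact h0.mono_measure (Measure.restrict_mono (hΩcoe ▸ hΩslab) le_rfl)
    exact (h1.aemeasurable.enorm.pow_const 3)
  have hint : ∫⁻ w in parabolicCylinder s z,
      (‖u w.1 w.2‖ₑ ^ (3 : ℕ) + ‖p w.1 w.2‖ₑ ^ (3 / 2 : ℝ)) ≤ ENNReal.ofReal (ε₀ ^ 3 * s ^ 2) := by
    rw [lintegral_add_left' hmeas]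
    have hs0 : ENNReal.ofReal s ^ 2 ≠ 0 := pow_ne_zero 2 (ENNReal.ofReal_pos.2 hs).ne'
    have hst : ENNReal.ofReal s ^ 2 ≠ ∞ := ENNReal.pow_ne_top ENNReal.ofReal_ne_top
    have h1 : (ENNReal.ofReal s ^ 2)⁻¹ * ((∫⁻ w in parabolicCylinder s z, ‖u w.1 w.2‖ₑ ^ (3 : ℕ)) +
        ∫⁻ w in parabolicCylinder s z, ‖p w.1 w.2‖ₑ ^ (3 / 2 : ℝ)) ≤ ENNReal.ofReal (ε₀ ^ 3) := by
      rw [mul_add]; exact hsmall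
    rw [ENNReal.inv_mul_le_iff hs0 hst] at h1
    refine h1.trans (le_of_eq ?_)
    rw [← ENNReal.ofReal_pow hs.le, ← ENNReal.ofReal_mul (by positivity), mul_comm]
  have hforce : ∫⁻ w in parabolicCylinder s z,
      ‖(0 : ℝ → EuclideanSpace ℝ (Fin 3) → EuclideanSpace ℝ (Fin 3)) w.1 w.2‖ₑ ^ (3 : ℝ) ≤
        ENNReal.ofReal (ε₀ ^ (2 * (3 : ℝ)) * s ^ (5 - 3 * (3 : ℝ))) := by
    simp [ENNReal.zero_rpow_of_pos (by norm_num : (0 : ℝ) < 3)]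
  have hb := H Ω 0 u p G₀ hLR z s ε₀ hs (by rw [hΩcoe]) hε₀.le le_rfl hint hforce
  exact hb.mono fun w hw => hw

/-! ### Uniform boundedness of the approximants below a regular top point -/

/-- **Uniform boundedness of local Leray approximants below a regular top point, unit
viscosity** (the quantitative content of Lemarié-Rieusset 2016, proof of Thm. 15.5, PDF
pp. 571–573, (15.5)–(15.6) with Thm. 14.4 = Rusin–Šverák 2011, Lemma 2.1, at the final time):
let `(v_n, π_n)` and `(v_∞, π_∞)` be local Leray solutions on `(0, T) × ℝ³` at unit viscosity
with `esssup_t sup_{x₀} ∫_{B(x₀,1)} |v_n(t)|² ≤ C`, `sup_{x₀} ∫₀ᵀ∫_{B(x₀,1)} |∇v_n|² ≤ C` and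
`v_n → v_∞` in `L²((0,T) × B(0,R))` for every `R`; if `v_∞` is essentially bounded on some
`Q_{r₀}(T, x₀)`, `r₀² < T`, then there are `r₁ > 0` and `K₁` such that `|v_n| ≤ K₁` a.e. on
`Q_{r₁}(T, x₀)` for all large `n`. Proof: word for word the tree's `singular_point_stability_unit`
(gauges with a uniform pressure bound; `L³` convergence on `Q_ρ`; the pressure decay estimate
iterated `J` times; the scale `s = θᴶ r_B`, which depends on the limit and on `C` only), closed by
the quantitative one-scale criterion `exists_oneScale_top_bound_of_LR`, so that `K₁ = K / s`.
[cite: LemarieRieusset2016, proof of Thm. 15.5, PDF pp. 571–573 (15.5)–(15.6) with Thm. 14.4] [cite: RusinSverak2011, Lemma 2.1] -/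
theorem uniform_top_bound_of_bounded_limit_unit
    {T : ℝ} (hT : 0 < T) (C : ℝ≥0)
    (a : ℕ → EuclideanSpace ℝ (Fin 3) → EuclideanSpace ℝ (Fin 3))
    (v : ℕ → ℝ → EuclideanSpace ℝ (Fin 3) → EuclideanSpace ℝ (Fin 3))
    (π : ℕ → ℝ → EuclideanSpace ℝ (Fin 3) → ℝ)
    (aL : EuclideanSpace ℝ (Fin 3) → EuclideanSpace ℝ (Fin 3))
    (vL : ℝ → EuclideanSpace ℝ (Fin 3) → EuclideanSpace ℝ (Fin 3))
    (πL : ℝ → EuclideanSpace ℝ (Fin 3) → ℝ)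
    (hv : ∀ n, IsLocalLeraySolutionOn T 1 (a n) (v n) (π n))
    (hvL : IsLocalLeraySolutionOn T 1 aL vL πL)
    (hC : ∀ n, ∀ᵐ t ∂(volume.restrict (Ioo 0 T)), ∀ x₀ : EuclideanSpace ℝ (Fin 3),
      ∫⁻ x in ball x₀ 1, ‖v n t x‖ₑ ^ 2 ≤ C)
    (hG : ∀ n, ∃ G : ℝ → EuclideanSpace ℝ (Fin 3) →
        EuclideanSpace ℝ (Fin 3) →L[ℝ] EuclideanSpace ℝ (Fin 3),
      HasWeakSpatialGradientOn (slab (EuclideanSpace ℝ (Fin 3)) (Ioo 0 T) isOpen_Ioo) (v n) G ∧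
        ∀ x₀ : EuclideanSpace ℝ (Fin 3), ∫⁻ z in Ioo 0 T ×ˢ ball x₀ 1,
          ENNReal.ofReal (frobeniusNormSq (G z.1 z.2)) ≤ C)
    (hconv : ∀ R : ℝ, 0 < R →
      Tendsto (fun n => ∫⁻ z in Ioo 0 T ×ˢ ball (0 : EuclideanSpace ℝ (Fin 3)) R,
        ‖v n z.1 z.2 - vL z.1 z.2‖ₑ ^ 2) atTop (𝓝 0))
    (x₀ : EuclideanSpace ℝ (Fin 3))
    (hreg : ∃ r₀ : ℝ, 0 < r₀ ∧ r₀ ^ 2 < T ∧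
      eLpNorm (uncurry vL) ∞ (volume.restrict (parabolicCylinder r₀ ((T : ℝ), x₀))) < ∞) :
    ∃ r₁ K₁ : ℝ, 0 < r₁ ∧ ∀ᶠ n in atTop,
      ∀ᵐ w ∂(volume.restrict (parabolicCylinder r₁ ((T : ℝ), x₀))), ‖v n w.1 w.2‖ ≤ K₁ := by
  have hε : lemarieRieusset_epsilon_regularity := lemarieRieusset_epsilon_regularity_holds
  have hPD : seregin_sverak_pressure_decay := seregin_sverak_pressure_decay_holds
  have hKP : kangMiuraTsai_local_pressure_bound := kangMiuraTsai_local_pressure_bound_holds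
  obtain ⟨r₀, hr₀, hr₀T, hbdd⟩ := hreg
  set z : ℝ × EuclideanSpace ℝ (Fin 3) := ((T : ℝ), x₀) with hz
  -- constants of the three facts
  obtain ⟨ε₀, K, hε₀, _hK, hOS⟩ := exists_oneScale_top_bound_of_LR hε
  obtain ⟨c, hPDr⟩ := hPD.ratio
  obtain ⟨θ, hθ, hθhalf, hcθ⟩ := exists_ratio_mul_le_half c
  have hθ1 : θ ≤ 1 := hθhalf.trans (by norm_num)
  -- (i) gauges with a uniform pressure bound
  obtain ⟨KP, hKPT⟩ := hKP T 1 (2 * C) hT one_pos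
  have hC2 : (C : ℝ≥0∞) ≤ ((2 * C : ℝ≥0) : ℝ≥0∞) := by
    push_cast
    exact le_mul_of_one_le_left bot_le one_le_two
  have hgauge : ∀ n, ∃ cg : ℝ → ℝ, MemLp cg (3 / 2 : ℝ≥0∞) (volume.restrict (Ioo 0 T)) ∧
      ∫⁻ w in Ioo 0 T ×ˢ ball x₀ 1, ‖π n w.1 w.2 - cg w.1‖ₑ ^ (3 / 2 : ℝ) ≤ KP := by
    intro n
    refine hKPT (a n) (v n) (π n) (hv n) (fun x₁ => ?_) ((hv n).isWeaklyDivFree_datum hT) ?_ ?_ x₀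
    · have h1 := (hv n).lintegral_ball_datum_le hT (hC n) x₁
      refine h1.trans (le_of_eq ?_)
      push_cast
      ring
    · filter_upwards [hC n] with t ht x₁
      exact (ht x₁).trans hC2
    · obtain ⟨G, hGn, hGb⟩ := hG n
      exact ⟨G, hGn, fun x₁ => (hGb x₁).trans hC2⟩
  choose cg hcg hcgb using hgauge
  set p : ℕ → ℝ → EuclideanSpace ℝ (Fin 3) → ℝ := fun n t x => π n t x - cg n t with hp
  have hgs : ∀ n, IsSuitableWeakSolutionOn (slab (EuclideanSpace ℝ (Fin 3)) (Ioo 0 T) isOpen_Ioo)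
      1 0 (v n) (p n) := fun n => (hv n).suitable.sub_timeGauge_slab (hcg n)
  -- the essential bound of the limit on `Q_{r₀}(z)`
  set M : ℝ≥0∞ := eLpNorm (uncurry vL) ∞ (volume.restrict (parabolicCylinder r₀ z)) with hMdef
  have hM : ∀ᵐ w ∂(volume.restrict (parabolicCylinder r₀ z)), ‖vL w.1 w.2‖ₑ ≤ M :=
    ae_enorm_le_eLpNorm_top vL _
  have hMtop : M ≠ ∞ := hbdd.ne
  -- (ii) the radius `ρ` and the `L³` convergence on `Q_ρ(z)`
  set ρ : ℝ := min r₀ 1 with hρdef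
  have hρ : 0 < ρ := lt_min hr₀ one_pos
  have hρ1 : ρ ≤ 1 := min_le_right _ _
  have hρr₀ : ρ ≤ r₀ := min_le_left _ _
  have hρT : ρ ^ 2 ≤ T := (pow_le_pow_left₀ hρ.le hρr₀ 2).trans hr₀T.le
  obtain ⟨CL, hCL⟩ := hvL.uniformLocalEnergy 1 one_pos
  obtain ⟨GLim, hGLim, hGLimb⟩ := hvL.uniformLocalGradient
  obtain ⟨CL', hCL'⟩ := hGLimb 1 one_pos
  set C' : ℝ≥0∞ := (C : ℝ≥0∞) + CL + CL' with hC'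
  have hC'top : C' ≠ ∞ := by simp [hC']
  have hCC' : (C : ℝ≥0∞) ≤ C' := by rw [hC', add_assoc]; exact le_self_add
  have hCLC' : (CL : ℝ≥0∞) ≤ C' := by
    rw [hC']; exact le_add_self.trans le_self_add
  have hCL'C' : (CL' : ℝ≥0∞) ≤ C' := by rw [hC']; exact le_add_self
  have hconv1 : Tendsto (fun n => ∫⁻ w in Ioo 0 T ×ˢ ball x₀ 1,
      ‖v n w.1 w.2 - vL w.1 w.2‖ₑ ^ 2) atTop (𝓝 0) := by
    have hsub : Ioo (0 : ℝ) T ×ˢ ball x₀ 1 ⊆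
        Ioo (0 : ℝ) T ×ˢ ball (0 : EuclideanSpace ℝ (Fin 3)) (‖x₀‖ + 1) := by
      refine prod_mono Subset.rfl fun y hy => ?_
      rw [mem_ball, dist_zero_right]
      rw [mem_ball, dist_eq_norm] at hy
      linarith [norm_sub_norm_le y x₀]
    exact tendsto_of_tendsto_of_tendsto_of_le_of_le tendsto_const_nhds
      (hconv (‖x₀‖ + 1) (by positivity)) (fun _ => bot_le) fun n => lintegral_mono_set hsub
  have hδ : Tendsto (fun n => ∫⁻ w in parabolicCylinder ρ z,
      ‖v n w.1 w.2 - vL w.1 w.2‖ₑ ^ (3 : ℕ)) atTop (𝓝 0) := by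
    refine tendsto_lintegral_cube_parabolicCylinder hρ hρ1 hρT hC'top
      (fun n => (hv n).aestronglyMeasurable) hvL.aestronglyMeasurable (fun n => ?_) (fun n => ?_)
      ?_ ?_ hconv1
    · filter_upwards [hC n] with t ht x₁
      exact (ht x₁).trans hCC'
    · obtain ⟨G, hGn, hGb⟩ := hG n
      exact ⟨G, hGn, (hGb x₀).trans hCC'⟩
    · filter_upwards [hCL] with t ht x₁
      exact (ht x₁).trans hCLC'
    · exact ⟨GLim, hGLim, (hCL' x₀).trans hCL'C'⟩
  -- constants
  set V₁ : ℝ≥0∞ := volume (ball (0 : EuclideanSpace ℝ (Fin 3)) 1) with hV₁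
  have hV₁top : V₁ ≠ ∞ := measure_ball_lt_top.ne
  set Θ : ℝ≥0∞ := ENNReal.ofReal ((θ⁻¹) ^ 2) with hΘ
  set L : ℝ≥0∞ := 1 + 2 * ((c : ℝ≥0∞) * Θ) with hL
  have hLtop : L ≠ ∞ := ENNReal.add_ne_top.2 ⟨ENNReal.one_ne_top, ENNReal.mul_ne_top
    ENNReal.ofNat_ne_top (ENNReal.mul_ne_top ENNReal.coe_ne_top ENNReal.ofReal_ne_top)⟩
  set ε : ℝ≥0∞ := ENNReal.ofReal (ε₀ ^ 3) with hεdef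
  have hε4 : 0 < ε / 4 :=
    ENNReal.div_pos (ENNReal.ofReal_pos.2 (by positivity)).ne' ENNReal.ofNat_ne_top
  -- (A) the starting radius `rB ≤ ρ`: `L · 4 |B₁| M³ rB³ ≤ ε/4`
  obtain ⟨rA, hrA, hA⟩ := exists_forall_ofReal_pow_three_mul_le (N := L * (4 * (V₁ * M ^ 3)))
    (ENNReal.mul_ne_top hLtop (ENNReal.mul_ne_top ENNReal.ofNat_ne_top
      (ENNReal.mul_ne_top hV₁top (ENNReal.pow_ne_top hMtop)))) hε4
  set rB : ℝ := min ρ rA with hrBdef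
  have hrB : 0 < rB := lt_min hρ hrA
  have hrBρ : rB ≤ ρ := min_le_left _ _
  have hrB1 : rB ≤ 1 := hrBρ.trans hρ1
  have hrBr₀ : rB ≤ r₀ := hrBρ.trans hρr₀
  have hrBT : rB ^ 2 ≤ T := (pow_le_pow_left₀ hrB.le hrBρ 2).trans hρT
  have hArB : ENNReal.ofReal (rB ^ 3) * (L * (4 * (V₁ * M ^ 3))) ≤ ε / 4 :=
    hA rB hrB (min_le_right _ _)
  -- (B) the number of steps `J`
  set P : ℝ≥0∞ := (ENNReal.ofReal rB ^ 2)⁻¹ * KP with hPdef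
  have hPtop : P ≠ ∞ :=
    ENNReal.mul_ne_top (ENNReal.inv_ne_top.2 (pow_ne_zero 2 (ENNReal.ofReal_pos.2 hrB).ne'))
      ENNReal.coe_ne_top
  obtain ⟨J, hJ⟩ := exists_inv_two_pow_mul_le hPtop hε4
  -- the final scale `s = θᴶ rB`
  set s : ℝ := θ ^ J * rB with hsdef
  have hs : 0 < s := by positivity
  have hsrB : s ≤ rB := mul_le_of_le_one_left hrB.le (pow_le_one₀ hθ.le hθ1)
  have hs1 : s ≤ 1 := hsrB.trans hrB1
  have hsT : s ^ 2 ≤ T := (pow_le_pow_left₀ hs.le hsrB 2).trans hrBT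
  have hscale0 : ∀ j : ℕ, 0 < θ ^ j * rB := fun j => by positivity
  have hscale1 : ∀ j : ℕ, θ ^ j * rB ≤ rB := fun j =>
    mul_le_of_le_one_left hrB.le (pow_le_one₀ hθ.le hθ1)
  have hscale2 : ∀ j ≤ J, s ≤ θ ^ j * rB := fun j hj =>
    mul_le_mul_of_nonneg_right (pow_le_pow_of_le_one hθ.le hθ1 hj) hrB.le
  -- (C) large `n`: the `L³` error is small at the scale `s`
  have hevT : ∀ᶠ n : ℕ in atTop, L * (4 * ((ENNReal.ofReal s ^ 2)⁻¹ *
      ∫⁻ w in parabolicCylinder ρ z, ‖v n w.1 w.2 - vL w.1 w.2‖ₑ ^ (3 : ℕ))) ≤ ε / 4 := by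
    have hfin : L * (4 * (ENNReal.ofReal s ^ 2)⁻¹) ≠ ∞ :=
      ENNReal.mul_ne_top hLtop (ENNReal.mul_ne_top ENNReal.ofNat_ne_top
        (ENNReal.inv_ne_top.2 (pow_ne_zero 2 (ENNReal.ofReal_pos.2 hs).ne')))
    have h1 := ENNReal.Tendsto.const_mul hδ (Or.inr hfin)
    rw [mul_zero] at h1
    have h2 : Tendsto (fun n : ℕ => L * (4 * ((ENNReal.ofReal s ^ 2)⁻¹ *
        ∫⁻ w in parabolicCylinder ρ z, ‖v n w.1 w.2 - vL w.1 w.2‖ₑ ^ (3 : ℕ)))) atTop (𝓝 0) := by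
      refine h1.congr fun n => ?_
      simp only [mul_assoc]
    exact h2.eventually (ge_mem_nhds hε4)
  refine ⟨s / 2, K / s, by positivity, ?_⟩
  filter_upwards [hevT] with n hnT
  -- the cubic inputs of the approximant `v n`
  set Tn : ℝ≥0∞ := ∫⁻ w in parabolicCylinder ρ z, ‖v n w.1 w.2 - vL w.1 w.2‖ₑ ^ (3 : ℕ) with hTn
  set e : ℝ≥0∞ := 4 * (V₁ * M ^ 3 * ENNReal.ofReal (rB ^ 3)) + 4 * ((ENNReal.ofReal s ^ 2)⁻¹ * Tn)
    with hedef
  have hCe : ∀ j ≤ J, cknC (θ ^ j * rB) z (v n) ≤ e := by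
    intro j hj
    have hQS : parabolicCylinder (θ ^ j * rB) z ⊆ parabolicCylinder r₀ z :=
      parabolicCylinder_mono (hscale0 j).le ((hscale1 j).trans hrBr₀) z
    have hQK : parabolicCylinder (θ ^ j * rB) z ⊆ parabolicCylinder ρ z :=
      parabolicCylinder_mono (hscale0 j).le ((hscale1 j).trans hrBρ) z
    refine (cknC_le_of_ae_bound_of_lintegral_sub (hscale0 j) hQS hQK hM le_rfl).trans ?_
    have h1 : ENNReal.ofReal ((θ ^ j * rB) ^ 3) ≤ ENNReal.ofReal (rB ^ 3) :=
      ENNReal.ofReal_le_ofReal (pow_le_pow_left₀ (hscale0 j).le (hscale1 j) 3)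
    have h2 : (ENNReal.ofReal (θ ^ j * rB) ^ 2)⁻¹ ≤ (ENNReal.ofReal s ^ 2)⁻¹ :=
      ENNReal.inv_le_inv.2 (pow_le_pow_left' (ENNReal.ofReal_le_ofReal (hscale2 j hj)) 2)
    rw [hedef]
    gcongr
  -- (iii) the pressure of the approximant at the last scale
  have hsubQ : parabolicCylinder rB z ⊆
      ((slab (EuclideanSpace ℝ (Fin 3)) (Ioo 0 T) isOpen_Ioo : Opens (ℝ × EuclideanSpace ℝ (Fin 3)))
        : Set (ℝ × EuclideanSpace ℝ (Fin 3))) := parabolicCylinder_top_subset_slab hrBT x₀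
  have hD : cknD s z (p n) ≤
      (2⁻¹ : ℝ≥0∞) ^ J * cknD rB z (p n) + 2 * ((c : ℝ≥0∞) * Θ * e) :=
    cknD_iterate_le_of_pressure_decay hPDr hθ hθ1 hcθ (hgs n).distributional hrB hsubQ
      (fun j hj => hCe j hj.le)
  have hD0 : cknD rB z (p n) ≤ P :=
    (cknD_le_of_subset (p n) (parabolicCylinder_top_subset_box hrB1 hrBT x₀)).trans
      (mul_le_mul' le_rfl (hcgb n))
  -- smallness `C + D ≤ ε` at the scale `s`
  have hsmall : cknC s z (v n) + cknD s z (p n) ≤ ε := by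
    have h1 : cknC s z (v n) ≤ e := hCe J le_rfl
    have h2 : L * e ≤ ε / 4 + ε / 4 := by
      rw [hedef, mul_add]
      refine add_le_add ?_ hnT
      calc L * (4 * (V₁ * M ^ 3 * ENNReal.ofReal (rB ^ 3)))
          = ENNReal.ofReal (rB ^ 3) * (L * (4 * (V₁ * M ^ 3))) := by ring
        _ ≤ ε / 4 := hArB
    have h3 : (2⁻¹ : ℝ≥0∞) ^ J * cknD rB z (p n) ≤ ε / 4 := le_trans (by gcongr) hJ
    calc cknC s z (v n) + cknD s z (p n)
        ≤ e + ((2⁻¹ : ℝ≥0∞) ^ J * cknD rB z (p n) + 2 * ((c : ℝ≥0∞) * Θ * e)) :=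
          add_le_add h1 hD
      _ = L * e + (2⁻¹ : ℝ≥0∞) ^ J * cknD rB z (p n) := by rw [hL]; ring
      _ ≤ (ε / 4 + ε / 4) + ε / 4 := add_le_add h2 h3
      _ ≤ ε := ENNReal.add_quarters_le ε
  -- Thm. 14.4 on `Ω = Q_s(T, x₀)`
  obtain ⟨G, hGn, hGb⟩ := hG n
  exact hOS T x₀ s (v n) (p n) C hs hs1 hsT (hgs n) (hC n)
    ⟨G, hGn, (hGb x₀).trans_lt ENNReal.coe_lt_top⟩ ((hcgb n).trans_lt ENNReal.coe_lt_top) hsmall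

end Literature.Analysis.FluidPDE

end
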